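import Summits.BirchSwinnertonDyer.Rank1Residual.Ordinary.Conjectures.KolyvaginKimDatumOfCanonicalDatum
import Summits.BirchSwinnertonDyer.Rank1Residual.GaloisImage.PropagatedStructureUnramified
import Literature.NumberTheory.GaloisRepresentations.ContinuousH1OrderTwo
import Literature.NumberTheory.GaloisRepresentations.LocalGlobalCohomologyDualityProofs
import Literature.NumberTheory.EllipticCurves.ArchimedeanKummerImageMaximal
import HarnessLib

/-!
# The Kolyvagin-class datum from a Kolyvagin system for Mazur–Rubin's CANONICAL SELMER STRUCTURE `𝓕_can` (the tree's
# `propagatedSelmerStructure`) and THE CANONICAL comparison maps — the last «shape» hypothesis discharged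
# (theorems only; nothing asserted; C-16 stays a CONJECTURE)

HONEST FRAMING (cell `b2b-bsdres`, run/shared/lean/b2b/bsd-rank1-residual/, verbatim in every
file): the goal of the cell is to DELETE the COMBINATION-SHAPED residual classes of the
Birch–Swinnerton-Dyer formula for ALL analytic-rank `≤ 1` elliptic curves over `ℚ` — "full BSD
formula for every rank `≤ 1` curve in class `C`" assembled STRICTLY from published theorems — so
that the rank-`≤ 1` remainder becomes exactly the CONSTRUCTION-SHAPED classes, which are TYPED
(missing-input `Prop`s), NOT attempted. This is not "finishing BSD". Seat `b2b-bsdres-additive-p3`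
(X8 prover B / X7 joint; typer-designate for the cell conjecture C-16 = hyp C120.1; ladder BSD:K3 hand-off to cell
`bsd-ssimc`). This file books nothing and moves no mark; X7 / X8 stay CONSTRUCTION-SHAPED; C-16 = CONJECTURE.

## What this file does

`KolyvaginKimDatumOfCanonicalDatum.lean` derives the ONE residual input of C-16 from a Kolyvagin system for THE CANONICAL datum on
`E[p^k·p]` and ANY Selmer structure `𝓕` that is Kummer-or-finer off `{vℓ, vp}`. The Selmer structure of Kato's Kolyvagin system is
Mazur–Rubin's `𝓕_can` (Def. 3.2.1: `H¹_f` at `v ∤ p`, no condition at `p`) propagated to `E[p^{k+1}]` — in the tree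
`propagatedSelmerStructure W p k` (team n1011, `GaloisImage/PropagatedStructure.lean`, Rubin 2011 §3.1), the structure of n1011's
THEOREM D outputs (`exists_isKolyvaginSystem_propagatedSelmerStructure*`). This file discharges the shape hypothesis for it:

* §1 `propagatedSelmerStructure_le_kummerSelmerStructure` — for odd `p`, at every place `v ≠ vp` (`vp ∋ p`):
  `𝓕_can,v ≤ 𝓛_v`. At a finite `v ∤ p` this is the tree's EQUALITY `propagatedSelmerStructure_inr_eq_kummerSelmerStructure`
  (n1011, unconditional: `H¹_f(ℚ_v, T_pE) ⊗` propagates onto the Kummer image, Rubin §3.1 / Milne I Cor. 3.4); at an infinite place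
  `H¹(ℝ, E[p^{k+1}]) = 0` for odd `p` (tree `eq_zero_of_odd_nsmul_eq_zero_infinitePlace`).
* §2 `kolyvaginKimDatum_of_isKolyvaginSystem_canonicalStructure` — `KolyvaginKimDatum … (k+1) …` from a Kolyvagin system
  `κ ∈ KS(E[p^k·p], 𝓕_can, D)` for THE CANONICAL datum `D` (primes in a Sakamoto `τ`-class, `HasCanonicalComparison`) with
  `κ_1 = κ(Q)` and Kim's reading — no hypothesis on `𝓕` or on the comparison maps remains.
* §3 `kuriharaExactOrderRankOneAtThree_of_isKolyvaginSystem_canonicalStructure` — the closed sentence: **C-16 ⟸ Poitou–Tate ∧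
  local Euler characteristic ∧ (on every letter: a Kolyvagin system for `(E[3^{k′}·3], 𝓕_can, THE CANONICAL datum)` with
  `κ_1 = κ((3^F·u)·P)` and Kim's reading of `κ_{ℓ}`)** — the displayed input is now LITERALLY the output type
  `D.IsKolyvaginSystem (propagatedSelmerStructure W 3 k′) κ` of the tree's «Euler system ⇒ Kolyvagin system» theorems
  (`GaloisImage/KolyvaginSystemOfEulerSystem*.lean`, from an Euler system of `T_3E` — Kato's, the OPEN/named input; Mazur–Rubin
  Thm. 3.2.4) plus the bottom-class identification (Thm. 5.2.12) and Kim's Thm. 3.13.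

References: B. Mazur, K. Rubin, Mem. AMS 799 (2004), Def. 3.2.1, Lemma 1.2.3, Thm. 3.2.4, Thm. 5.2.12 [MazurRubin2004]; K. Rubin,
PCMI 18 (2011) §3.1 [Rubin2011]; R. Sakamoto, JTNB 36 (2024) §2, Def. 4.1 [Sakamoto2024]; C.-H. Kim, arXiv:2203.12159, §2.2.2,
Thm. 3.13, (5.3) [Kim2022StructureSelmer]; J. S. Milne, ADT (2006) I Cor. 3.4, Rem. 3.7, 2.8, 4.10(b) [MilneADT2006];
J.-P. Serre, Galois Cohomology I §2.4 [SerreGaloisCohomology1997].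
-/

noncomputable section

open scoped Classical MatrixGroups

open CongruenceSubgroup WeierstrassCurve Literature.NumberTheory.EllipticCurves
  Literature.NumberTheory.EllipticCurves.ModularForms
  Literature.NumberTheory.EllipticCurves.Rank1Residual
  Literature.NumberTheory.GaloisRepresentations Literature.NumberTheory.GaloisCohomology
  Literature.NumberTheory.GaloisRepresentations.DiscreteGaloisModule
  Function NumberField IsDedekindDomain Field
  Summit.BirchSwinnertonDyer.Rank1Residual.GaloisImage

namespace Summit.BirchSwinnertonDyer.Rank1Residual.Ordinary

/-! ### §1 `𝓕_can ≤ Kummer` off the place of `p` (odd `p`) -/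

section Structure

variable (W : WeierstrassCurve ℚ) [W.IsElliptic] (p k : ℕ) [hp : Fact p.Prime]

omit [W.IsElliptic] in
/-- **`H¹(ℚ_w, E[p^k·p]) = 0` at an infinite place `w` for odd `p`** (odd torsion dies in the cohomology of a group of order
`≤ 2`; tree `eq_zero_of_odd_nsmul_eq_zero_infinitePlace`). [cite: SerreGaloisCohomology1997, I §2.4] [cite: MilneADT2006, I Rem. 3.7] -/
theorem galoisCohomology_toLocal_inl_powMul_eq_zero (hp2 : p ≠ 2) (w : InfinitePlace ℚ)
    (y : galoisCohomology ((W.torsionGaloisModule ((p : ℤ) ^ k * (p : ℤ))).toLocal (Sum.inl w)) 1) : y = 0 := by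
  have hodd : Odd ((p : ℤ) ^ k * (p : ℤ)).natAbs := by
    rw [Int.natAbs_mul, Int.natAbs_pow, Int.natAbs_natCast]
    exact (hp.out.odd_of_ne_two hp2).pow.mul (hp.out.odd_of_ne_two hp2)
  exact eq_zero_of_odd_nsmul_eq_zero_infinitePlace w _ hodd y
    (galoisCohomology.nsmul_eq_zero_of_forall _ (fun T => W.natAbs_nsmul_geomTorsion T) y)

/-- **`𝓕_can,v ≤ 𝓛_v` at every place `v ≠ vp` for odd `p`** (`𝓕_can` = the tree's `propagatedSelmerStructure W p k` on
`E[p^k·p]`, `𝓛` = the Kummer structure): EQUALITY at every finite `v ∤ p` (n1011's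
`propagatedSelmerStructure_inr_eq_kummerSelmerStructure`), and `H¹ = 0` at the infinite place. This is the hypothesis `h𝓕` of
`kolyvaginKimDatum_of_isKolyvaginSystem_canonical` for Mazur–Rubin's canonical structure.
[cite: MazurRubin2004, Def. 3.2.1] [cite: Rubin2011, §3.1 (p. 29)] [cite: MilneADT2006, Ch. I, Cor. 3.4 and Rem. 3.7] -/
theorem propagatedSelmerStructure_le_kummerSelmerStructure (hp2 : p ≠ 2) {vp : HeightOneSpectrum (𝓞 ℚ)}
    (hvp : ((p : ℕ) : 𝓞 ℚ) ∈ vp.asIdeal) (v : Place ℚ) (hv : v ≠ Sum.inr vp) :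
    propagatedSelmerStructure W p k v ≤ W.kummerSelmerStructure ((p : ℤ) ^ k * (p : ℤ)) v := by
  cases v with
  | inl w =>
    intro y _
    rw [galoisCohomology_toLocal_inl_powMul_eq_zero W p k hp2 w y]
    exact zero_mem _
  | inr q =>
    have hpq : ((p : ℕ) : 𝓞 ℚ) ∉ q.asIdeal := by
      intro h
      apply hv
      rw [(natCast_mem_asIdeal_iff_eq_primesEquiv_symm q hp.out).mp h,
        (natCast_mem_asIdeal_iff_eq_primesEquiv_symm vp hp.out).mp hvp]
    exact (propagatedSelmerStructure_inr_eq_kummerSelmerStructure W p k hpq).le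

end Structure

/-! ### §2 The datum from a Kolyvagin system for `(E[p^k·p], 𝓕_can, canonical datum)` -/

section Canonical

variable (W : WeierstrassCurve ℚ) [W.IsElliptic] {N : ℕ} (f : CuspForm (Gamma0 N) 2)
  (p ℓ k₀ k : ℕ) [hp : Fact p.Prime] [Fact ℓ.Prime] (Q : W.toAffine.Point) (vℓ vp : HeightOneSpectrum (𝓞 ℚ))
  (ψ : (q : ℕ) → (ZMod q)ˣ →* Multiplicative (ZMod (p ^ k₀)))

/-- **`KolyvaginKimDatum` at depth `k + 1` from a Kolyvagin system for `(E[p^k·p], 𝓕_can, THE CANONICAL datum)`** (odd `p`):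
`kolyvaginKimDatum_of_isKolyvaginSystem_canonical` with `𝓕 = propagatedSelmerStructure W p k` and its shape hypothesis discharged by
§1. Displayed: Sakamoto's `(S, τ)` with (H.2) and `τ` fixing `μ_{p^{k+1}}`, the canonical datum `D` (primes in the `τ`-class,
`HasCanonicalComparison`), `vℓ ∈ 𝒫`, `vℓ ∤ p` good, `vp ∋ p`, a Kolyvagin system `κ` with `κ_1 = κ(Q)`, Kim's reading.
[cite: MazurRubin2004, Def. 3.2.1, Lemma 1.2.3, Thm. 3.2.4 and Thm. 5.2.12] [cite: Sakamoto2024, §2 (p. 921) and Def. 4.1 (p. 926)]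
[cite: Kim2022StructureSelmer, §2.2.2 and Thm. 3.13] -/
theorem kolyvaginKimDatum_of_isKolyvaginSystem_canonicalStructure (hp2 : p ≠ 2)
    (S : Set (HeightOneSpectrum (𝓞 ℚ))) {τ : absoluteGaloisGroup ℚ}
    (hτq : Nonempty (cokerSubOne (W.torsionGaloisModule ((p : ℤ) ^ k * (p : ℤ))) τ ≃+ ZMod (p ^ (k + 1))))
    (hτμ : τ ∈ rootsOfUnityFixer ℚ (p ^ (k + 1)))
    {D : KolyvaginDatum (W.torsionGaloisModule ((p : ℤ) ^ k * (p : ℤ)))}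
    (hP : D.primes ⊆ frobeniusClassPrimes (W.torsionGaloisModule ((p : ℤ) ^ k * (p : ℤ))) S τ (p ^ (k + 1)))
    {ηr : (q : HeightOneSpectrum (𝓞 ℚ)) → (ZMod (Ideal.absNorm q.asIdeal))ˣ}
    (hD : D.HasCanonicalComparison (p ^ (k + 1)) ηr) (hDℓ : vℓ ∈ D.primes)
    (hdiv : ∀ P : geomPoints W, ∃ R : geomPoints W, ((p : ℤ) ^ k * (p : ℤ)) • R = P)
    (hpv : ((p : ℕ) : 𝓞 ℚ) ∉ vℓ.asIdeal) (hgood : W.HasGoodReductionAt vℓ) (hvp : ((p : ℕ) : 𝓞 ℚ) ∈ vp.asIdeal)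
    {κ : Finset (HeightOneSpectrum (𝓞 ℚ)) → galoisCohomology (W.torsionGaloisModule ((p : ℤ) ^ k * (p : ℤ))) 1}
    (hκ : D.IsKolyvaginSystem (propagatedSelmerStructure W p k) κ)
    (h1 : κ ∅ = kummerMapTorsion W ((p : ℤ) ^ k * (p : ℤ)) hdiv Q)
    (hkim : ∀ ψp : galoisCohomology ((W.torsionGaloisModule ((p : ℤ) ^ k * (p : ℤ))).toLocal (Sum.inr vp)) 1 ⧸
        W.kummerSelmerStructure ((p : ℤ) ^ k * (p : ℤ)) (Sum.inr vp) ≃+ ZMod (p ^ (k + 1)),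
      (haveI : NeZero ℓ := ⟨(Fact.out : ℓ.Prime).ne_zero⟩
       zmodPowOrd p k₀ (kuriharaNumber f (p ^ k₀) ℓ ψ)) =
        min k₀ (zmodPowOrd p (k + 1)
          (ψp (galoisCohomology.localization (W.torsionGaloisModule ((p : ℤ) ^ k * (p : ℤ))) (Sum.inr vp) 1
            (κ {vℓ}))))) :
    KolyvaginKimDatum W f p ℓ k₀ (k + 1) Q vℓ vp ψ :=
  kolyvaginKimDatum_of_isKolyvaginSystem_canonical W f p ℓ k₀ k Q vℓ vp ψ S hτq hτμ hP hD hDℓ hdiv hpv hgood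
    (fun v _ hv => propagatedSelmerStructure_le_kummerSelmerStructure W p k hp2 hvp v hv) hκ h1 hkim

end Canonical

/-! ### §3 The closed sentence: a Kolyvagin system for `(E[3^{k′}·3], 𝓕_can, canonical datum)` on every letter -/

section Closed

/-- **C-16 (closed sentence) ⟸ Poitou–Tate over `ℚ` ∧ local Euler characteristic at every `ℚ_v` ∧, on C-16's letter,
a KOLYVAGIN SYSTEM FOR `(E[3^{k′}·3], 𝓕_can, THE CANONICAL DATUM)` with Kim's reading.** For every surjective `ψ`: a depth
`k′ + 1 ≥ k` with `ℓ ∈ 𝒫_{k′+1}`, a unit `u`, Sakamoto's `(S, τ)` ((H.2) at `3^{k′+1}`, `τ` fixing `μ_{3^{k′+1}}`), a Kolyvagin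
datum `KD` on `E[3^{k′}·3]` with primes in the `τ`-class and THE CANONICAL comparison maps, `vℓ ∈ KD.primes`, a divisibility
witness, and `κ` with `KD.IsKolyvaginSystem (propagatedSelmerStructure W 3 k′) κ` — Mazur–Rubin's `𝓕_can` — whose bottom class is
`κ((3^F·u)·P)` and whose class `κ_{ℓ}` has Kim's reading at `v₃`. The displayed input is the output type of the tree's
«Euler system ⇒ Kolyvagin system» theorems for an Euler system of `T_3E` (Kato's: OPEN at `3`, print for `p ≥ 5` — Mazur–Rubin
Thm. 3.2.4) plus Thm. 5.2.12's bottom class and Kim's Thm. 3.13. Nothing asserted; C-16 stays a CONJECTURE.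
[cite: MazurRubin2004, Def. 3.2.1, Thm. 3.2.4 and Thm. 5.2.12] [cite: Kim2022StructureSelmer, Thm. 3.13 and (5.3)]
[cite: Sakamoto2024, §2 (p. 921)] [cite: MilneADT2006, Ch. I, Thm. 4.10(b) and Thm. 2.8] -/
theorem kuriharaExactOrderRankOneAtThree_of_isKolyvaginSystem_canonicalStructure
    (hPT : poitouTate_sum_localTatePairing_eq_zero ℚ)
    (hEP : ∀ v : HeightOneSpectrum (𝓞 ℚ), localEulerPoincareCharacteristic (v.adicCompletion ℚ))
    (hcore : ∀ (W : WeierstrassCurve ℚ) [W.IsElliptic] [W.IsGloballyMinimal],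
      W.analyticRank = 1 →
      ∀ (P : W.toAffine.Point), ¬ IsOfFinAddOrder P →
        (∀ Q : W.toAffine.Point, ∃ n : ℤ, IsOfFinAddOrder (Q - n • P)) →
      (∀ T : W.toAffine.Point, 3 • T = 0 → T = 0) →
      W.HasSurjectiveModNGaloisRep 3 →
      W.HasGoodReductionAtPrime 3 → W.frobeniusTrace 3 ≠ 1 → W.frobeniusTrace 3 ≠ -2 →
      ¬ O5.PointLocallyThreeDivisibleAt W 3 P →
      ∀ (q : ℚ) (s : ℕ), shaAn W = (q : ℂ) → padicValRat 3 q = s →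
      ∀ {N : ℕ} [NeZero N] (D : ModularParametrizationData W N),
        ¬ (3 : ℤ) ∣ D.maninConstant →
        (∃ u : ℚ, ‖(u : ℚ_[3])‖ = 1 ∧ W.realPeriodRat = u * plusPeriod D.f) →
      ∀ (ℓ k : ℕ) [Fact ℓ.Prime], 1 ≤ k → Kato.IsKolyvaginPrime W 3 k ℓ →
        IsCyclicKolyvaginLevel W 3 ℓ →
      ∀ (vℓ v₃ : HeightOneSpectrum (𝓞 ℚ)), (ℓ : 𝓞 ℚ) ∈ vℓ.asIdeal → ((3 : ℕ) : 𝓞 ℚ) ∈ v₃.asIdeal →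
        ∀ ψ : (q : ℕ) → (ZMod q)ˣ →* Multiplicative (ZMod (3 ^ k)),
          (∀ q ∈ ℓ.primeFactors, Function.Surjective (ψ q)) →
            ∃ (k' : ℕ) (_ : k ≤ k' + 1) (_ : Kato.IsKolyvaginPrime W 3 (k' + 1) ℓ) (u : ℕ) (_ : ¬ 3 ∣ u)
              (S : Set (HeightOneSpectrum (𝓞 ℚ))) (τ : absoluteGaloisGroup ℚ)
              (_ : haveI : Fact (Nat.Prime 3) := ⟨Nat.prime_three⟩
                Nonempty (cokerSubOne (W.torsionGaloisModule (((3 : ℕ) : ℤ) ^ k' * ((3 : ℕ) : ℤ))) τ ≃+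
                  ZMod (3 ^ (k' + 1))))
              (_ : τ ∈ rootsOfUnityFixer ℚ (3 ^ (k' + 1)))
              (KD : KolyvaginDatum (W.torsionGaloisModule (((3 : ℕ) : ℤ) ^ k' * ((3 : ℕ) : ℤ))))
              (_ : KD.primes ⊆ frobeniusClassPrimes (W.torsionGaloisModule (((3 : ℕ) : ℤ) ^ k' * ((3 : ℕ) : ℤ)))
                S τ (3 ^ (k' + 1)))
              (ηr : (q : HeightOneSpectrum (𝓞 ℚ)) → (ZMod (Ideal.absNorm q.asIdeal))ˣ)
              (_ : haveI : Fact (Nat.Prime 3) := ⟨Nat.prime_three⟩; KD.HasCanonicalComparison (3 ^ (k' + 1)) ηr)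
              (_ : vℓ ∈ KD.primes)
              (hdiv : ∀ X : geomPoints W, ∃ R : geomPoints W, (((3 : ℕ) : ℤ) ^ k' * ((3 : ℕ) : ℤ)) • R = X)
              (κ : Finset (HeightOneSpectrum (𝓞 ℚ)) →
                galoisCohomology (W.torsionGaloisModule (((3 : ℕ) : ℤ) ^ k' * ((3 : ℕ) : ℤ))) 1)
              (_ : haveI : Fact (Nat.Prime 3) := ⟨Nat.prime_three⟩
                KD.IsKolyvaginSystem (propagatedSelmerStructure W 3 k') κ)
              (_ : κ ∅ = kummerMapTorsion W (((3 : ℕ) : ℤ) ^ k' * ((3 : ℕ) : ℤ)) hdiv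
                ((3 ^ (s + padicValNat 3 W.tamagawaProduct) * u) • P)),
              ∀ ψp : galoisCohomology ((W.torsionGaloisModule (((3 : ℕ) : ℤ) ^ k' * ((3 : ℕ) : ℤ))).toLocal
                    (Sum.inr v₃)) 1 ⧸
                  W.kummerSelmerStructure (((3 : ℕ) : ℤ) ^ k' * ((3 : ℕ) : ℤ)) (Sum.inr v₃) ≃+ ZMod (3 ^ (k' + 1)),
                (haveI : NeZero ℓ := ⟨(Fact.out : ℓ.Prime).ne_zero⟩
                 zmodPowOrd 3 k (kuriharaNumber D.f (3 ^ k) ℓ ψ)) =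
                  min k (zmodPowOrd 3 (k' + 1) (ψp (galoisCohomology.localization
                    (W.torsionGaloisModule (((3 : ℕ) : ℤ) ^ k' * ((3 : ℕ) : ℤ))) (Sum.inr v₃) 1 (κ {vℓ}))))) :
    KuriharaExactOrderRankOneAtThree :=
  haveI h3 : Fact (Nat.Prime 3) := ⟨Nat.prime_three⟩
  kuriharaExactOrderRankOneAtThree_of_kolyvaginKimDatum hPT hEP
    fun W _ _ hr P hP hgen htors hsurj hgood ha1 ha2 hm0 q s hq hs N _ D hManin hper ℓ k _ hk hKP hcyc vℓ v₃ hvℓ hv₃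
      ψ hψ => by
      obtain ⟨k', hkn, hKPn, u, hu, S, τ, hτq, hτμ, KD, hPr, ηr, hD, hDℓ, hdiv, κ, hκ, h1, hkim⟩ :=
        hcore W hr P hP hgen htors hsurj hgood ha1 ha2 hm0 q s hq hs D hManin hper ℓ k hk hKP hcyc vℓ v₃ hvℓ hv₃ ψ hψ
      obtain ⟨hpv, hgoodℓ⟩ := IsKolyvaginPrime.not_mem_and_hasGoodReductionAt W hKPn hvℓ
      exact ⟨k' + 1, hkn, hKPn, u, hu, kolyvaginKimDatum_of_isKolyvaginSystem_canonicalStructure W D.f 3 ℓ k k' _ vℓ v₃ ψ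
        (by decide) S hτq hτμ hPr hD hDℓ hdiv hpv hgoodℓ hv₃ hκ h1 hkim⟩

end Closed

end Summit.BirchSwinnertonDyer.Rank1Residual.Ordinary

end
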